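import Summits.QuantumFields.YangMills.Theorems.BalabanLadderNTMarkovMirrorFloor
import Summits.QuantumFields.YangMills.Theorems.LangevinControlUVOSLegsFromFemtoAndGapStubAssemblyPlaneExpansion
import Literature.MathematicalPhysics.QuantumFieldTheory.ActionDensityTimeReflection
import HarnessLib

/-!
# Crux `NT` (stmt-QuantumFields-19353) / `UVSeamRec.stub_floorsEngine` (stmt-QuantumFields-20043):
# `Q2(θv, v)` IS a mirror form — the time-chirality of the corner density, exactly

Fifth file of the Markov–mirror series (fleet lead prover of crux `UVSeamRec`, unit `ym-spine-20043-p1`, g6).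
Card E (`Cruxes/NT/Ideas/markov-mirror-dirichlet-response.md`) bills the identification of the clause-(i)
quantity `Q2_{β,L,a}(θv, v)` with the mirror form `Cov_T(Ṽ∘Θ₀, Ṽ)` of the smeared corner density
`Ṽ = ∑_y v(a·y) dens_y` as a separate two-point CEILING (`ShiftCeiling`, `O(a)`, E0′-grade): the corner density
`dens` is not `Θ₀`-covariant (its three electric plaquettes sit ABOVE the corner).  This file removes the ceiling
from the identification step: by the tree's chirality formula `actionDensity_cfgReflect`
(`Literature/…/ActionDensityTimeReflection.lean`), `dens_{θ₀x} = densᴿ_x ∘ Θ₀` EXACTLY, where the reflected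
species `densᴿ_x` reads the magnetic plaquettes at `x` and the electric ones one step DOWN (`x − e₀`).  Hence

  `Q2_{β,L,a}(θv, v) = Cov_T(Wᴿ∘Θ₀, Ṽ)`  EXACTLY,  `Wᴿ := ∑_x v(a·x) densᴿ_x`

(`Q2_thetaTest_eq_torusCov_reflSmear`) — a MIXED mirror form of two cube-carried cylinders, to which the Markov
mirror factorisation of `…MarkovMirrorReflect` applies with `F₁ = Wᴿ ≠ F₂ = Ṽ`.  The defect `Wᴿ − Ṽ` is a
discrete time-derivative of `v` against electric plaquette fields; its boundary response is `O(a)` by a ONE-point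
boundary law (next file), so no two-point ceiling is needed anywhere on the line.

* §1 `torusE_sum_mul`, `torusCov_sum_sum` — (bi)linearity of torus expectations over finite smearings;
* §2 `configShift_single_configShift_neg`, `dens_siteReflect` — the chirality formula at a site:
  `dens_{θ₀x} V = ∑_{q} plane_q(x or x − e₀)(Θ₀V)`;
* §3 `sum_box_siteReflect`, `Q2_thetaTest_eq_torusCov_reflSmear`.

Refs: Osterwalder–Seiler 1978 §2 (site reflection, invariance of `Re tr`); card E §ShiftCeiling; tree
`ActionDensityTimeReflection` (module docstring: «this defect … is what makes Wilson-lattice reflection positivity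
of smeared CORNER densities only approximate»).
-/

set_option autoImplicit false

noncomputable section

open scoped SchwartzMap
open MeasureTheory Filter Topology
open Literature.MathematicalPhysics.QuantumFieldTheory Literature.MathematicalPhysics.QuantumLattice
open Literature.Probability.LatticeModels
open Summit.QuantumFields.YangMills.Cruxes.OSLegsFromFemtoAndGap.DlrCollarTransfer
open Summit.QuantumFields.YangMills.Theorems.OSLegsFromFemtoAndGap (dens_eq_sum_filter_plane)
open Summit.QuantumFields.YangMills.Cruxes.OSLegsAtWeakCouplingC.InheritedAmplitudeGates.StubInherit
  (integrable_lift)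

namespace Summit.QuantumFields.YangMills.Cruxes.NT.MarkovMirror

/-! ## §1 (Bi)linearity of torus expectations over finite smearings -/

section Linear

variable (G : Type) [Group G] [TopologicalSpace G] [IsTopologicalGroup G] [CompactSpace G]
  [MeasurableSpace G] [BorelSpace G] (r : LatticeRep G)

/-- Torus expectation of a finite weighted sum of continuous observables. [folklore] -/
theorem torusE_sum_mul (β : ℝ) (L : ℕ) {ι : Type*} (S : Finset ι) (α : ι → ℝ) (F : ι → LGConfig 4 G → ℝ)
    (hF : ∀ i ∈ S, Continuous (F i)) :
    torusE G r β L (fun V => ∑ i ∈ S, α i * F i V) = ∑ i ∈ S, α i * torusE G r β L (F i) := by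
  unfold torusE
  rw [integral_finsetSum S (fun i hi => (integrable_lift G r β (hF i hi)).const_mul (α i))]
  exact Finset.sum_congr rfl fun i _ => integral_const_mul _ _

/-- **Covariance of two finite smearings is the double sum of the covariances.**  For finite families of
continuous observables `F i`, `H k` and weights `α`, `γ`, on the torus of side `2L+1`:
`Cov_T(∑ αᵢFᵢ, ∑ γₖHₖ) = ∑ᵢ ∑ₖ αᵢ γₖ Cov_T(Fᵢ, Hₖ)` (all read through the periodic lift). [folklore] -/
theorem torusCov_sum_sum (β : ℝ) (L : ℕ) {ι κ : Type*} (S : Finset ι) (T : Finset κ) (α : ι → ℝ) (γ : κ → ℝ)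
    (F : ι → LGConfig 4 G → ℝ) (H : κ → LGConfig 4 G → ℝ) (hF : ∀ i ∈ S, Continuous (F i))
    (hH : ∀ k ∈ T, Continuous (H k)) :
    torusE G r β L (fun V => (∑ i ∈ S, α i * F i V) * (∑ k ∈ T, γ k * H k V)) -
        torusE G r β L (fun V => ∑ i ∈ S, α i * F i V) * torusE G r β L (fun V => ∑ k ∈ T, γ k * H k V) =
      ∑ i ∈ S, ∑ k ∈ T, α i * γ k *
        (torusE G r β L (fun V => F i V * H k V) - torusE G r β L (F i) * torusE G r β L (H k)) := by
  -- the product of the two smearings as a double smearing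
  have e1 : (fun V : LGConfig 4 G => (∑ i ∈ S, α i * F i V) * (∑ k ∈ T, γ k * H k V)) =
      fun V => ∑ i ∈ S, α i * (∑ k ∈ T, γ k * (F i V * H k V)) := by
    funext V
    rw [Finset.sum_mul]
    refine Finset.sum_congr rfl fun i _ => ?_
    rw [Finset.mul_sum, Finset.mul_sum]
    refine Finset.sum_congr rfl fun k _ => ?_
    ring
  have hFH : ∀ i ∈ S, Continuous fun V => ∑ k ∈ T, γ k * (F i V * H k V) := fun i hi =>
    continuous_finsetSum _ fun k hk => continuous_const.mul ((hF i hi).mul (hH k hk))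
  rw [e1, torusE_sum_mul G r β L S α _ hFH, torusE_sum_mul G r β L S α F hF, torusE_sum_mul G r β L T γ H hH]
  have e2 : ∀ i ∈ S, torusE G r β L (fun V => ∑ k ∈ T, γ k * (F i V * H k V)) =
      ∑ k ∈ T, γ k * torusE G r β L (fun V => F i V * H k V) := fun i hi =>
    torusE_sum_mul G r β L T γ (fun k V => F i V * H k V) fun k hk => (hF i hi).mul (hH k hk)
  rw [Finset.sum_congr rfl fun i hi => by rw [e2 i hi], Finset.sum_mul_sum, ← Finset.sum_sub_distrib]
  refine Finset.sum_congr rfl fun i _ => ?_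
  rw [Finset.mul_sum, ← Finset.sum_sub_distrib]
  refine Finset.sum_congr rfl fun k _ => ?_
  ring

end Linear

/-! ## §2 Time-chirality of the corner density at a site -/

section Chiral

variable (G : Type) [Group G] [TopologicalSpace G] [IsTopologicalGroup G] [CompactSpace G]
  [MeasurableSpace G] [BorelSpace G] (r : LatticeRep G)

omit [Group G] [TopologicalSpace G] [IsTopologicalGroup G] [CompactSpace G] [BorelSpace G] in
/-- `τ_{e₀} ∘ τ_{−x} = τ_{−(x − e₀)}` on `ℤ⁴` gauge fields (`τ_v = configShift v`). [folklore] -/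
theorem configShift_single_configShift_neg (x : Fin 4 → ℤ) (V : LGConfig 4 G) :
    configShift (Pi.single 0 1) (configShift (-x) V) = configShift (-(x - Pi.single 0 1)) V := by
  funext e
  simp only [Literature.MathematicalPhysics.QuantumLattice.configShift_apply]
  congr 2
  abel

/-- **Chirality of the corner density at a site.**  For the site reflection `θ₀` and the field reflection
`Θ₀ = cfgReflect`: `dens_{θ₀x}(V) = ∑_{q = (i<j)} plane_q(x_q)(Θ₀V)` with `x_q = x − e₀` for the three electric
orientations (`i = 0`) and `x_q = x` for the three magnetic ones — the action density at the reflected site is the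
REFLECTED-species density (electric plaquettes read one step down) of the reflected field.  (Tree
`actionDensity_cfgReflect` transported by `cfgReflect_configShift`.) [cite: OsterwalderSeiler1978, §2] -/
theorem dens_siteReflect (x : Fin 4 → ℤ) (V : LGConfig 4 G) :
    dens G r (siteReflect x) V =
      ∑ q : {q : Fin 4 × Fin 4 // q.1 < q.2},
        plane G r q.1 (if q.1.1 = 0 then x - Pi.single 0 1 else x) (cfgReflect V) := by
  have h1 : configShift (-siteReflect x) V = cfgReflect (configShift (-x) (cfgReflect V)) := by
    rw [cfgReflect_configShift, cfgReflect_cfgReflect, siteReflect_neg]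
  unfold dens
  change actionDensity r.ρ (configShift (-siteReflect x) V) = _
  rw [h1, actionDensity_cfgReflect r.ρ r.continuous]
  refine Finset.sum_congr rfl fun q _ => ?_
  unfold plane
  split_ifs with h
  · rw [configShift_single_configShift_neg]
  · rfl

end Chiral

/-! ## §3 `Q2(θv, v)` as the mixed mirror form `Cov_T(Wᴿ∘Θ₀, Ṽ)` -/

section Q2

variable (G : Type) [Group G] [TopologicalSpace G] [IsTopologicalGroup G] [CompactSpace G]
  [MeasurableSpace G] [BorelSpace G] (r : LatticeRep G)

/-- Re-indexing a sum over the symmetric box by the site reflection `θ₀` (an involution of `box 4 L`). [folklore] -/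
theorem sum_box_siteReflect (L : ℕ) (f : (Fin 4 → ℤ) → ℝ) :
    ∑ x ∈ box 4 L, f (siteReflect x) = ∑ x ∈ box 4 L, f x :=
  Finset.sum_nbij' siteReflect siteReflect (fun _ hx => siteReflect_mem_box hx)
    (fun _ hx => siteReflect_mem_box hx) (fun x _ => siteReflect_siteReflect x)
    (fun x _ => siteReflect_siteReflect x) (fun _ _ => rfl)

/-- **`Q2(θv, v)` is the mixed mirror form of the reflected-species smearing against the smearing.**  On the
torus of side `2L+1`, at spacing `s`, for a test function `v` whose lattice support `{y : v(s·y) ≠ 0}` lies in a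
cube `Q ⊆ box 4 L`:
`Q2 G r β L s (θv) v = torusE[(Wᴿ∘Θ₀) · Ṽ] − torusE[Wᴿ∘Θ₀] · torusE[Ṽ]`, where `Ṽ = ∑_{y∈Q} v(s·y) dens_y` and
`Wᴿ = ∑_{x∈Q} v(s·x) ∑_q plane_q(x_q)` is the reflected-species smearing (`x_q = x − e₀` electric, `x` magnetic).
EXACT — no `O(s)` term: the re-indexing `x ↦ θ₀x` of the box and the site chirality formula `dens_siteReflect`.
[folklore] -/
theorem Q2_thetaTest_eq_torusCov_reflSmear (β : ℝ) (L : ℕ) (s : ℝ) (v : 𝓢(EuclideanSpace ℝ (Fin 4), ℝ))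
    (c : Fin 4 → ℤ) (b : ℕ) (hsub : cubeSites c b ⊆ box 4 L)
    (hsupp : ∀ y : Fin 4 → ℤ, v (s • siteToE y) ≠ 0 → y ∈ cubeSites c b) :
    Q2 G r β L s (thetaTest 4 v) v =
      torusE G r β L (fun V =>
          (∑ x ∈ cubeSites c b, v (s • siteToE x) *
              ∑ q : {q : Fin 4 × Fin 4 // q.1 < q.2},
                plane G r q.1 (if q.1.1 = 0 then x - Pi.single 0 1 else x) (cfgReflect V)) *
            (∑ y ∈ cubeSites c b, v (s • siteToE y) * dens G r y V)) -
        torusE G r β L (fun V => ∑ x ∈ cubeSites c b, v (s • siteToE x) *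
            ∑ q : {q : Fin 4 × Fin 4 // q.1 < q.2},
              plane G r q.1 (if q.1.1 = 0 then x - Pi.single 0 1 else x) (cfgReflect V)) *
          torusE G r β L (fun V => ∑ y ∈ cubeSites c b, v (s • siteToE y) * dens G r y V) := by
  -- the reflected-species smearing is `∑_x v(s·x) dens_{θ₀x}`
  simp only [← dens_siteReflect G r]
  -- bilinear expansion of the right-hand side
  rw [torusCov_sum_sum G r β L (cubeSites c b) (cubeSites c b) (fun x => v (s • siteToE x))
      (fun y => v (s • siteToE y)) (fun x => dens G r (siteReflect x)) (fun y => dens G r y)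
      (fun x _ => continuous_dens r _) (fun y _ => continuous_dens r _)]
  -- the left-hand side: re-index `x ↦ θ₀x`, then restrict both sums to the cube
  unfold Q2
  have step1 : ∀ y : Fin 4 → ℤ,
      ∑ x ∈ box 4 L, thetaTest 4 v (s • siteToE x) * v (s • siteToE y) *
          (torusE G r β L (fun U => dens G r x U * dens G r y U) -
            torusE G r β L (dens G r x) * torusE G r β L (dens G r y)) =
        ∑ x ∈ box 4 L, v (s • siteToE x) * v (s • siteToE y) *
          (torusE G r β L (fun U => dens G r (siteReflect x) U * dens G r y U) -
            torusE G r β L (dens G r (siteReflect x)) * torusE G r β L (dens G r y)) := by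
    intro y
    rw [← sum_box_siteReflect L (fun x => v (s • siteToE x) * v (s • siteToE y) *
      (torusE G r β L (fun U => dens G r (siteReflect x) U * dens G r y U) -
        torusE G r β L (dens G r (siteReflect x)) * torusE G r β L (dens G r y)))]
    refine Finset.sum_congr rfl fun x _ => ?_
    simp only [thetaTest_apply, timeReflection_smul_siteToE, siteReflect_siteReflect]
  rw [Finset.sum_comm, Finset.sum_congr rfl fun y _ => step1 y, Finset.sum_comm]
  -- restrict the `x`-sum and the `y`-sum to the cube
  symm
  refine Eq.trans (Finset.sum_subset hsub fun x _ hx => ?_) (Finset.sum_congr rfl fun x _ => ?_)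
  · refine Finset.sum_eq_zero fun y _ => ?_
    have : v (s • siteToE x) = 0 := by by_contra h; exact hx (hsupp x h)
    rw [this]; ring
  · exact Finset.sum_subset hsub fun y _ hy => by
      have : v (s • siteToE y) = 0 := by by_contra h; exact hy (hsupp y h)
      rw [this]; ring

end Q2

end Summit.QuantumFields.YangMills.Cruxes.NT.MarkovMirror

end
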